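import Literature.NumberTheory.EllipticCurves.DivisionPointsKernelMembership
import Literature.NumberTheory.ComplexMultiplication.EllipticUnits.DeShalitDivisionPointsLatticeVbarCube
import HarnessLib

/-!
# (N1) ASSEMBLED when `v̄³ ∣ 𝔣`: `ξ(u_{m+1})` read on the lane curve `[1, −1, 0, −2, −1]` lies in `E₁(M)` — from readings only,
# WITHOUT `2^k ∉ 𝔣` (de Shalit II.4.4 (iv) at the split prime `2 = 𝔭𝔭̄`; tame set `S = ∅` included — proofs only)

Topic `NumberTheory/EllipticCurves` (theorems only; no definition, no named fact, no instance).  Cell `bsd-print-cf2`, width seat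
`bsd-line-cf2-p1-w5` g18, piece (N1)-S∅ = (N1)-PKG v3, sequel of `DivisionPointsKernelMembership` ((N1)-PKG v2, -w5 g17).

(N1)-PKG v2 `some_mem_kernel_divisionPt_of_readings` carries the hypothesis `∀ k, 2^k ∉ 𝔣`.  On the lane the modulus is
`𝔣 = 𝔪_M = ∏_{w ∈ S ∪ {v̄}} w^M` and `2^M ∈ 𝔪_M` exactly when the tame set `S` is empty (`𝔣 = v̄^M`), so v2 is unavailable there.  The
hypothesis served only five lattice side conditions (`π₀ ∉ 𝔣`, `𝔣 ≠ ⊤`, `Ω + (k·u_{N+1} + ub) ∉ L`, `α(Ω + (…)) ∉ L`, and the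
exclusion `α(k·u_{N+1} + ub) + 2αΩ ∉ L`), all of which `DeShalitDivisionPointsLatticeVbarCube` proves from `𝔣 ≤ (π₁³)` with `π₁` prime
and `π₀ + π₁ = 1` (the exclusion genuinely needs the cube: it fails at `𝔣 = (π₁²)`).  Hence:

* ★★★ `some_mem_kernel_divisionPt_of_readings_of_le_span_cube` — **`ι_vξ(u_{m+1}) ∈ E₁(M)`**, the statement of (N1)-PKG v2 VERBATIM with
  the `2^k` hypothesis replaced by `(hprime₁ : Prime π₁) (h𝔣π₁ : 𝔣 ≤ Ideal.span {π₁ ^ 3})` — valid for every lane modulus `𝔪_M` with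
  `M ≥ 3`, `S = ∅` included (`v̄^M ∣ 𝔪_M`); the consumers (`…SeamBridgeOfReadings` / `…OfLane`, B10f-e) twin accordingly and P1 takes
  `M₁ ≥ 3`.

No summit statement is proved; BSD is not proved by any of this.

## References
* [deShalit1987] E. de Shalit, *Iwasawa theory of elliptic curves with complex multiplication* (1987), II §1.10, II §4.4 (iv), II §4.9 (ii).
* [SilvermanAEC2009] J. H. Silverman, *The Arithmetic of Elliptic Curves*, 2nd ed. (2009), III.2.3, VI.3.6 (b), VII.2.1–VII.2.2.
-/

noncomputable section

open scoped Classical PeriodPair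
open Polynomial

namespace Literature.NumberTheory.EllipticCurves

open ValuativeRel Literature.NumberTheory.GaloisRepresentations
  Literature.NumberTheory.GaloisRepresentations.IsNonarchimedeanLocalField
  Literature.NumberTheory.GaloisRepresentations.LubinTate Field NumberField
open Literature.NumberTheory.EllipticCurves.FormalGroupChart _root_.WeierstrassCurve _root_.PeriodPair
open Literature.NumberTheory.ComplexMultiplication.EllipticUnits

section Assembly

variable {F : Type} [Field F] [ValuativeRel F] [TopologicalSpace F] [IsNonarchimedeanLocalField F]

attribute [local instance] ltNormUniformSpace ltNormIsUniformAddGroup rk1 nF nE fintypeResidueField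

variable {p : ℕ} [Fact p.Prime] (e : 𝒪[F] ≃+* ℤ_[p]) (hq : residueFieldCard F = p)
  {π : 𝒪[F]} (hπ : (valuation F).IsUniformizer (π : F)) {πZ : ℤ_[p]} (he : e π = πZ)
  (hA : IsLTRing πZ p) {P : PowerSeries ℤ_[p]} (hP : IsLTSeries πZ p P)
  (hV : ((⟨1, -1, 0, -2, -1⟩ : WeierstrassCurve ℤ).map (Int.castRingHom ℤ_[p])).formalGroupLaw = ltF hA hP)
  {ϖ : ℤ_[p]} (hp : (p : ℤ_[p]) = ϖ * πZ) (hϖ : IsUnit ϖ)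
  (M : IntermediateField F (AlgebraicClosure F)) [FiniteDimensional F M]
  [hEll : (curveOver M (((⟨1, -1, 0, -2, -1⟩ : WeierstrassCurve ℤ).map (Int.castRingHom ℤ_[p])).map ((LTCoeff.of F).toRingHom.comp e.symm.toRingHom))).IsElliptic]
  {Kb : Type*} [Field Kb] (ιc : Kb →+* ℂ) (ιv : Kb →+* AlgebraicClosure F)
  {R : Type*} [CommRing R] (ψ : R →+* unitBall M) (j : R →+* Kb)
  (hψj : ∀ r : R, ((((ψ r : unitBall M) : M) : AlgebraicClosure F)) = ιv (j r))
  (L : PeriodPair) (h₂ : L.g₂ = ((⟨1, -1, 0, -2, -1⟩ : WeierstrassCurve ℤ).baseChange ℂ).c₄ / 12) (h₃ : L.g₃ = ((⟨1, -1, 0, -2, -1⟩ : WeierstrassCurve ℤ).baseChange ℂ).c₆ / 216)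
  {K : Type} [Field K] (ι₀ : K →+* ℂ) {𝔣 : Ideal (𝓞 K)} {Ω : ℂ}
  (hL : ∀ z : ℂ, z ∈ L.lattice ↔ ∃ a ∈ 𝔣, z = Ω * ι₀ (a : K)) {β π₀ π₁ : 𝓞 K}


include hq hπ he hV hp hϖ hψj h₂ h₃ hL in
set_option maxHeartbeats 1600000 in
/-- ★★★ **(N1) assembled, modulus divisible by `v̄³` (tame set `S = ∅` included): `ι_vξ(u_{m+1}) ∈ E₁(M)` from readings** — the
statement of `some_mem_kernel_divisionPt_of_readings` VERBATIM except that the hypothesis `∀ k, 2^k ∉ 𝔣` (false for `𝔣 = v̄^M`) is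
replaced by `(hprime₁ : Prime π₁) (h𝔣π₁ : 𝔣 ≤ Ideal.span {π₁ ^ 3})` (every lane modulus `𝔪_M`, `M ≥ 3`).  Proof: the original, with the
lattice side conditions `π₀ ∉ 𝔣`, `𝔣 ≠ ⊤`, `Ω + (…) ∉ L`, `α(Ω + (…)) ∉ L` and the exclusion `α(…) + 2αΩ ∉ L` now taken from
`DeShalitDivisionPointsLatticeVbarCube`. [cite: deShalit1987, II §4.4 (iv), II §4.9 Proposition (ii)] [cite: SilvermanAEC2009, III.2.3, VII.2.1–VII.2.2] -/
theorem some_mem_kernel_divisionPt_of_readings_of_le_span_cube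
    -- the CM presentation (as in `DivisionPointsLaneCoherence.ltSMul_zPt_eq_inclPt_zPt_of_readings`, `W := [1, −1, 0, −2, −1]`)
    {αR : R} {PC QC : ℂ[X]}
    (hT : ∀ z : ℂ, z ∉ L.lattice → ιc (j αR) * z ∉ L.lattice → PC.eval (℘[L] z) = ℘[L] (ιc (j αR) * z) * QC.eval (℘[L] z))
    {Pr Qr : R[X]} {s : ℂ} (hs : s ≠ 0)
    (hQr : Qr.map (ιc.comp j) = C s * QC.comp (X + C (((⟨1, -1, 0, -2, -1⟩ : WeierstrassCurve ℤ).baseChange ℂ).b₂ / 12)))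
    (hPr : Pr.map (ιc.comp j) = C s * (PC.comp (X + C (((⟨1, -1, 0, -2, -1⟩ : WeierstrassCurve ℤ).baseChange ℂ).b₂ / 12)) -
      C (((⟨1, -1, 0, -2, -1⟩ : WeierstrassCurve ℤ).baseChange ℂ).b₂ / 12) * QC.comp (X + C (((⟨1, -1, 0, -2, -1⟩ : WeierstrassCurve ℤ).baseChange ℂ).b₂ / 12))))
    {T : PowerSeries R} (hT0 : PowerSeries.constantCoeff T = 0)
    (hTP : T.map ψ = (P.map ((LTCoeff.of F).toRingHom.comp e.symm.toRingHom)).map (algebraMap (LTCoeff F) (unitBall M)))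
    {x₀ y₀ x₁ y₁ : R}
    (hidX : ((((⟨1, -1, 0, -2, -1⟩ : WeierstrassCurve ℤ).map (Int.castRingHom R)).translateX x₁ y₁).subst T + PowerSeries.C (0 : R)) * Polynomial.aeval (((⟨1, -1, 0, -2, -1⟩ : WeierstrassCurve ℤ).map (Int.castRingHom R)).translateX x₀ y₀ + PowerSeries.C (0 : R)) Qr =
      Polynomial.aeval (((⟨1, -1, 0, -2, -1⟩ : WeierstrassCurve ℤ).map (Int.castRingHom R)).translateX x₀ y₀ + PowerSeries.C (0 : R)) Pr)
    (hidY : PowerSeries.C αR * (2 * PowerSeries.subst T (((⟨1, -1, 0, -2, -1⟩ : WeierstrassCurve ℤ).map (Int.castRingHom R)).translateY x₁ y₁) +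
            PowerSeries.C ((⟨1, -1, 0, -2, -1⟩ : WeierstrassCurve ℤ).map (Int.castRingHom R)).a₁ * PowerSeries.subst T (((⟨1, -1, 0, -2, -1⟩ : WeierstrassCurve ℤ).map (Int.castRingHom R)).translateX x₁ y₁) + PowerSeries.C ((⟨1, -1, 0, -2, -1⟩ : WeierstrassCurve ℤ).map (Int.castRingHom R)).a₃) *
          Polynomial.aeval (((⟨1, -1, 0, -2, -1⟩ : WeierstrassCurve ℤ).map (Int.castRingHom R)).translateX x₀ y₀ + PowerSeries.C (0 : R)) Qr +
        (PowerSeries.subst T (((⟨1, -1, 0, -2, -1⟩ : WeierstrassCurve ℤ).map (Int.castRingHom R)).translateX x₁ y₁) + PowerSeries.C (0 : R)) *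
          Polynomial.aeval (((⟨1, -1, 0, -2, -1⟩ : WeierstrassCurve ℤ).map (Int.castRingHom R)).translateX x₀ y₀ + PowerSeries.C (0 : R)) (Polynomial.derivative Qr) *
          (2 * ((⟨1, -1, 0, -2, -1⟩ : WeierstrassCurve ℤ).map (Int.castRingHom R)).translateY x₀ y₀ + PowerSeries.C ((⟨1, -1, 0, -2, -1⟩ : WeierstrassCurve ℤ).map (Int.castRingHom R)).a₁ * ((⟨1, -1, 0, -2, -1⟩ : WeierstrassCurve ℤ).map (Int.castRingHom R)).translateX x₀ y₀ + PowerSeries.C ((⟨1, -1, 0, -2, -1⟩ : WeierstrassCurve ℤ).map (Int.castRingHom R)).a₃) =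
      Polynomial.aeval (((⟨1, -1, 0, -2, -1⟩ : WeierstrassCurve ℤ).map (Int.castRingHom R)).translateX x₀ y₀ + PowerSeries.C (0 : R)) (Polynomial.derivative Pr) *
        (2 * ((⟨1, -1, 0, -2, -1⟩ : WeierstrassCurve ℤ).map (Int.castRingHom R)).translateY x₀ y₀ + PowerSeries.C ((⟨1, -1, 0, -2, -1⟩ : WeierstrassCurve ℤ).map (Int.castRingHom R)).a₁ * ((⟨1, -1, 0, -2, -1⟩ : WeierstrassCurve ℤ).map (Int.castRingHom R)).translateX x₀ y₀ + PowerSeries.C ((⟨1, -1, 0, -2, -1⟩ : WeierstrassCurve ℤ).map (Int.castRingHom R)).a₃))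
    -- the model lattice `L = Ω·ι₀(𝔣)`, the split prime `2 = π₀π₁`, the CM multiplier `α = ι₀(π₀)`, the lane prime `p = 2`
    (hΩ : Ω ≠ 0) (htr : π₀ + π₁ = 1) (hβ : β * π₀ - 1 ∈ 𝔣) (h2K : (2 : 𝓞 K) = π₀ * π₁)
    (hp0 : Prime π₀) (hndvd : ¬ π₀ ∣ π₁) (hprime₁ : Prime π₁) (h𝔣π₁ : 𝔣 ≤ Ideal.span {π₁ ^ 3})
    -- a primitive `𝔭̄`-division point `ub` of `ℂ/L` (`ub = Ω·ι₀(γ)`, `γ ∈ (𝔣 : v̄) ∖ 𝔣`)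
    {ub : ℂ} (hub1 : ι₀ (π₁ : K) * ub ∈ L.lattice) (hub0 : ub ∉ L.lattice)
    (hα : ιc (j αR) = ι₀ (π₀ : K)) (hp2 : p = 2) (hw2 : NormedField.valuation (K := M) 2 < 1) (h20 : (2 : M) ≠ 0)
    (hQ : ∀ w : ℂ, w ∉ L.lattice → ιc (j αR) * w ∉ L.lattice → QC.eval (℘[L] w) ≠ 0)
    -- the base points `ξ(Ω)`, `ξ(αΩ)` over `R`
    (hx₀ : ιc (j x₀) = ℘[L] (Ω) - ((⟨1, -1, 0, -2, -1⟩ : WeierstrassCurve ℤ).baseChange ℂ).b₂ / 12)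
    (hy₀ : ιc (j y₀) = (℘'[L] (Ω) - ((⟨1, -1, 0, -2, -1⟩ : WeierstrassCurve ℤ).baseChange ℂ).a₁ * (℘[L] (Ω) - ((⟨1, -1, 0, -2, -1⟩ : WeierstrassCurve ℤ).baseChange ℂ).b₂ / 12) - ((⟨1, -1, 0, -2, -1⟩ : WeierstrassCurve ℤ).baseChange ℂ).a₃) / 2)
    (hx₁ : ιc (j x₁) = ℘[L] (ιc (j αR) * Ω) - ((⟨1, -1, 0, -2, -1⟩ : WeierstrassCurve ℤ).baseChange ℂ).b₂ / 12)
    (hy₁ : ιc (j y₁) = (℘'[L] (ιc (j αR) * Ω) - ((⟨1, -1, 0, -2, -1⟩ : WeierstrassCurve ℤ).baseChange ℂ).a₁ * (℘[L] (ιc (j αR) * Ω) - ((⟨1, -1, 0, -2, -1⟩ : WeierstrassCurve ℤ).baseChange ℂ).b₂ / 12) - ((⟨1, -1, 0, -2, -1⟩ : WeierstrassCurve ℤ).baseChange ℂ).a₃) / 2)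
    -- the four reading families (levels `N ≤ m`, all `k : ℕ`)
    {m : ℕ} (xY yY : ℕ → Kb) (XY YY : ℕ → M)
    (hxY : ∀ N ≤ m, ιc (xY N) = ℘[L] ((ι₀ ((β ^ (N + 1) : 𝓞 K) : K) * Ω - Ω / ι₀ ((π₀ ^ (N + 1) : 𝓞 K) : K))) - ((⟨1, -1, 0, -2, -1⟩ : WeierstrassCurve ℤ).baseChange ℂ).b₂ / 12)
    (hyY : ∀ N ≤ m, ιc (yY N) = (℘'[L] ((ι₀ ((β ^ (N + 1) : 𝓞 K) : K) * Ω - Ω / ι₀ ((π₀ ^ (N + 1) : 𝓞 K) : K))) - ((⟨1, -1, 0, -2, -1⟩ : WeierstrassCurve ℤ).baseChange ℂ).a₁ * (℘[L] ((ι₀ ((β ^ (N + 1) : 𝓞 K) : K) * Ω - Ω / ι₀ ((π₀ ^ (N + 1) : 𝓞 K) : K))) - ((⟨1, -1, 0, -2, -1⟩ : WeierstrassCurve ℤ).baseChange ℂ).b₂ / 12) - ((⟨1, -1, 0, -2, -1⟩ : WeierstrassCurve ℤ).baseChange ℂ).a₃) / 2)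
    (hXY : ∀ N ≤ m, ((XY N : M) : AlgebraicClosure F) = ιv (xY N)) (hYY : ∀ N ≤ m, ((YY N : M) : AlgebraicClosure F) = ιv (yY N))
    (xS yS : ℕ → ℕ → Kb) (XS YS : ℕ → ℕ → M)
    (hxS : ∀ N ≤ m, ∀ k : ℕ, ιc (xS N k) = ℘[L] ((k : ℂ) * (ι₀ ((β ^ (N + 1) : 𝓞 K) : K) * Ω - Ω / ι₀ ((π₀ ^ (N + 1) : 𝓞 K) : K)) + ub) - ((⟨1, -1, 0, -2, -1⟩ : WeierstrassCurve ℤ).baseChange ℂ).b₂ / 12)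
    (hyS : ∀ N ≤ m, ∀ k : ℕ, ιc (yS N k) = (℘'[L] ((k : ℂ) * (ι₀ ((β ^ (N + 1) : 𝓞 K) : K) * Ω - Ω / ι₀ ((π₀ ^ (N + 1) : 𝓞 K) : K)) + ub) - ((⟨1, -1, 0, -2, -1⟩ : WeierstrassCurve ℤ).baseChange ℂ).a₁ * (℘[L] ((k : ℂ) * (ι₀ ((β ^ (N + 1) : 𝓞 K) : K) * Ω - Ω / ι₀ ((π₀ ^ (N + 1) : 𝓞 K) : K)) + ub) - ((⟨1, -1, 0, -2, -1⟩ : WeierstrassCurve ℤ).baseChange ℂ).b₂ / 12) - ((⟨1, -1, 0, -2, -1⟩ : WeierstrassCurve ℤ).baseChange ℂ).a₃) / 2)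
    (hXS : ∀ N ≤ m, ∀ k : ℕ, ((XS N k : M) : AlgebraicClosure F) = ιv (xS N k))
    (hYS : ∀ N ≤ m, ∀ k : ℕ, ((YS N k : M) : AlgebraicClosure F) = ιv (yS N k))
    (xW yW : ℕ → ℕ → Kb) (XW YW : ℕ → ℕ → M)
    (hxW : ∀ N ≤ m, ∀ k : ℕ, ιc (xW N k) = ℘[L] (Ω + ((k : ℂ) * (ι₀ ((β ^ (N + 1) : 𝓞 K) : K) * Ω - Ω / ι₀ ((π₀ ^ (N + 1) : 𝓞 K) : K)) + ub)) - ((⟨1, -1, 0, -2, -1⟩ : WeierstrassCurve ℤ).baseChange ℂ).b₂ / 12)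
    (hyW : ∀ N ≤ m, ∀ k : ℕ, ιc (yW N k) = (℘'[L] (Ω + ((k : ℂ) * (ι₀ ((β ^ (N + 1) : 𝓞 K) : K) * Ω - Ω / ι₀ ((π₀ ^ (N + 1) : 𝓞 K) : K)) + ub)) - ((⟨1, -1, 0, -2, -1⟩ : WeierstrassCurve ℤ).baseChange ℂ).a₁ * (℘[L] (Ω + ((k : ℂ) * (ι₀ ((β ^ (N + 1) : 𝓞 K) : K) * Ω - Ω / ι₀ ((π₀ ^ (N + 1) : 𝓞 K) : K)) + ub)) - ((⟨1, -1, 0, -2, -1⟩ : WeierstrassCurve ℤ).baseChange ℂ).b₂ / 12) - ((⟨1, -1, 0, -2, -1⟩ : WeierstrassCurve ℤ).baseChange ℂ).a₃) / 2)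
    (hXW : ∀ N ≤ m, ∀ k : ℕ, ((XW N k : M) : AlgebraicClosure F) = ιv (xW N k))
    (hYW : ∀ N ≤ m, ∀ k : ℕ, ((YW N k : M) : AlgebraicClosure F) = ιv (yW N k))
    (xZ yZ : ℕ → ℕ → Kb) (XZ YZ : ℕ → ℕ → M)
    (hxZ : ∀ N ≤ m, ∀ k : ℕ, ιc (xZ N k) = ℘[L] (ιc (j αR) * (Ω + ((k : ℂ) * (ι₀ ((β ^ (N + 1) : 𝓞 K) : K) * Ω - Ω / ι₀ ((π₀ ^ (N + 1) : 𝓞 K) : K)) + ub))) - ((⟨1, -1, 0, -2, -1⟩ : WeierstrassCurve ℤ).baseChange ℂ).b₂ / 12)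
    (hyZ : ∀ N ≤ m, ∀ k : ℕ, ιc (yZ N k) = (℘'[L] (ιc (j αR) * (Ω + ((k : ℂ) * (ι₀ ((β ^ (N + 1) : 𝓞 K) : K) * Ω - Ω / ι₀ ((π₀ ^ (N + 1) : 𝓞 K) : K)) + ub))) - ((⟨1, -1, 0, -2, -1⟩ : WeierstrassCurve ℤ).baseChange ℂ).a₁ * (℘[L] (ιc (j αR) * (Ω + ((k : ℂ) * (ι₀ ((β ^ (N + 1) : 𝓞 K) : K) * Ω - Ω / ι₀ ((π₀ ^ (N + 1) : 𝓞 K) : K)) + ub))) - ((⟨1, -1, 0, -2, -1⟩ : WeierstrassCurve ℤ).baseChange ℂ).b₂ / 12) - ((⟨1, -1, 0, -2, -1⟩ : WeierstrassCurve ℤ).baseChange ℂ).a₃) / 2)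
    (hXZ : ∀ N ≤ m, ∀ k : ℕ, ((XZ N k : M) : AlgebraicClosure F) = ιv (xZ N k))
    (hYZ : ∀ N ≤ m, ∀ k : ℕ, ((YZ N k : M) : AlgebraicClosure F) = ιv (yZ N k))
    {hn : (curveOver M (((⟨1, -1, 0, -2, -1⟩ : WeierstrassCurve ℤ).map (Int.castRingHom ℤ_[p])).map ((LTCoeff.of F).toRingHom.comp e.symm.toRingHom))).toAffine.Nonsingular (XY m) (YY m)} :
    (.some (XY m) (YY m) hn : (curveOver M (((⟨1, -1, 0, -2, -1⟩ : WeierstrassCurve ℤ).map (Int.castRingHom ℤ_[p])).map ((LTCoeff.of F).toRingHom.comp e.symm.toRingHom))).toAffine.Point) ∈ kernel (NormedField.valuation (K := M)) (curveOver M (((⟨1, -1, 0, -2, -1⟩ : WeierstrassCurve ℤ).map (Int.castRingHom ℤ_[p])).map ((LTCoeff.of F).toRingHom.comp e.symm.toRingHom))) := by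
  -- lattice side conditions
  have h𝔣sq : 𝔣 ≤ Ideal.span {π₁ ^ 2} := le_span_sq_of_le_span_cube h𝔣π₁
  have hπ₀𝔣 : π₀ ∉ 𝔣 := by simpa using pow_notMem_of_le_span_pow hprime₁ htr (n := 3) (by norm_num) h𝔣π₁ 1
  have h𝔣top : 𝔣 ≠ ⊤ := ne_top_of_le_span_pow hprime₁ (n := 3) (by norm_num) h𝔣π₁
  have hΩL : Ω ∉ L.lattice := notMem_lattice_of_model ι₀ hL hΩ h𝔣top
  have hαΩ : ιc (j αR) * Ω ∉ L.lattice := by rw [hα]; exact mul_gen_notMem ι₀ hL hΩ hπ₀𝔣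
  have huN : ∀ N : ℕ, (ι₀ ((β ^ (N + 1) : 𝓞 K) : K) * Ω - Ω / ι₀ ((π₀ ^ (N + 1) : 𝓞 K) : K)) ∉ L.lattice := fun N => divisionPt_succ_notMem ι₀ hL hΩ h2K hp0 hndvd N
  have hSN : ∀ N k : ℕ, (k : ℂ) * (ι₀ ((β ^ (N + 1) : 𝓞 K) : K) * Ω - Ω / ι₀ ((π₀ ^ (N + 1) : 𝓞 K) : K)) + ub ∉ L.lattice := fun N k =>
    nsmul_divisionPt_add_notMem ι₀ hL htr hβ hp0.ne_zero hub1 hub0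
  have hWN : ∀ N k : ℕ, Ω + ((k : ℂ) * (ι₀ ((β ^ (N + 1) : 𝓞 K) : K) * Ω - Ω / ι₀ ((π₀ ^ (N + 1) : 𝓞 K) : K)) + ub) ∉ L.lattice := fun N k =>
    base_add_nsmul_divisionPt_add_notMem_of_le_span_sq ι₀ hL hΩ hprime₁ htr hβ hp0.ne_zero hub1 h𝔣sq
  have hZN : ∀ N k : ℕ, ιc (j αR) * (Ω + ((k : ℂ) * (ι₀ ((β ^ (N + 1) : 𝓞 K) : K) * Ω - Ω / ι₀ ((π₀ ^ (N + 1) : 𝓞 K) : K)) + ub)) ∉ L.lattice := fun N k => by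
    rw [hα]; exact mul_base_add_nsmul_divisionPt_add_notMem_of_le_span_sq ι₀ hL hΩ hprime₁ htr hβ hp0.ne_zero hub1 h𝔣sq
  have hαSN : ∀ N k : ℕ, ιc (j αR) * ((k : ℂ) * (ι₀ ((β ^ (N + 1) : 𝓞 K) : K) * Ω - Ω / ι₀ ((π₀ ^ (N + 1) : 𝓞 K) : K)) + ub) ∉ L.lattice := fun N k => by
    rw [hα]; exact mul_nsmul_divisionPt_add_notMem ι₀ hL htr hβ hp0.ne_zero hub1 hub0
  have hexclN : ∀ N k : ℕ, ιc (j αR) * ((k : ℂ) * (ι₀ ((β ^ (N + 1) : 𝓞 K) : K) * Ω - Ω / ι₀ ((π₀ ^ (N + 1) : 𝓞 K) : K)) + ub) + 2 * (ιc (j αR) * Ω) ∉ L.lattice := fun N k => by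
    rw [hα]; exact mul_nsmul_divisionPt_add_add_two_mul_notMem_of_le_span_cube ι₀ hL hΩ hprime₁ htr h2K hβ hp0.ne_zero hub1 h𝔣π₁
  -- nonsingularity of the readings; the points `Y N`, `S N k`
  have hnY : ∀ N : ℕ, ∀ hN : N ≤ m, (curveOver M (((⟨1, -1, 0, -2, -1⟩ : WeierstrassCurve ℤ).map (Int.castRingHom ℤ_[p])).map ((LTCoeff.of F).toRingHom.comp e.symm.toRingHom))).toAffine.Nonsingular (XY N) (YY N) := fun N hN =>
    nonsingular_curveOver_of_readings e M _ ιc ιv L h₂ h₃ (huN N) (hxY N hN) (hyY N hN) (hXY N hN) (hYY N hN)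
  have hnS : ∀ N : ℕ, ∀ hN : N ≤ m, ∀ k : ℕ, (curveOver M (((⟨1, -1, 0, -2, -1⟩ : WeierstrassCurve ℤ).map (Int.castRingHom ℤ_[p])).map ((LTCoeff.of F).toRingHom.comp e.symm.toRingHom))).toAffine.Nonsingular (XS N k) (YS N k) := fun N hN k =>
    nonsingular_curveOver_of_readings e M _ ιc ιv L h₂ h₃ (hSN N k) (hxS N hN k) (hyS N hN k) (hXS N hN k) (hYS N hN k)
  let Ypt : ℕ → (curveOver M (((⟨1, -1, 0, -2, -1⟩ : WeierstrassCurve ℤ).map (Int.castRingHom ℤ_[p])).map ((LTCoeff.of F).toRingHom.comp e.symm.toRingHom))).toAffine.Point := fun N => if hN : N ≤ m then .some (XY N) (YY N) (hnY N hN) else 0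
  let Spt : ℕ → ℕ → (curveOver M (((⟨1, -1, 0, -2, -1⟩ : WeierstrassCurve ℤ).map (Int.castRingHom ℤ_[p])).map ((LTCoeff.of F).toRingHom.comp e.symm.toRingHom))).toAffine.Point := fun N k => if hN : N ≤ m then .some (XS N k) (YS N k) (hnS N hN k) else 0
  have hYpt : ∀ N : ℕ, ∀ hN : N ≤ m, Ypt N = .some (XY N) (YY N) (hnY N hN) := fun N hN => by simp only [Ypt, dif_pos hN]
  have hSpt : ∀ N : ℕ, ∀ hN : N ≤ m, ∀ k : ℕ, Spt N k = .some (XS N k) (YS N k) (hnS N hN k) := fun N hN k => by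
    simp only [Spt, dif_pos hN]
  have h0m : 0 ≤ m := Nat.zero_le _
  -- orders
  have htor : ∀ N ≤ m, 2 ^ (N + 1) • Ypt N = 0 := by
    intro N hN
    rw [hYpt N hN]
    refine nsmul_some_eq_zero_of_readings e M ιc ιv L h₂ h₃ (huN N) (2 ^ (N + 1)) ?_ (hxY N hN) (hyY N hN) (hXY N hN) (hYY N hN)
    have h := two_pow_mul_divisionPt_mem ι₀ hL hβ hp0.ne_zero h2K (N + 1)
    exact_mod_cast h
  have hR2 : 2 • Spt 0 0 = 0 := by
    rw [hSpt 0 h0m 0]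
    refine nsmul_some_eq_zero_of_readings e M ιc ιv L h₂ h₃ (hSN 0 0) 2 ?_ (hxS 0 h0m 0) (hyS 0 h0m 0) (hXS 0 h0m 0) (hYS 0 h0m 0)
    have h := two_mul_mem_of_mul_mem ι₀ hL hub1 h2K
    convert h using 1
    push_cast
    ring
  have hR0 : Spt 0 0 ≠ 0 := by rw [hSpt 0 h0m 0]; exact Affine.Point.some_ne_zero _
  -- `S N 0 = S 0 0 = R` and `S N k = k • Y N + R`
  have hS0 : ∀ N : ℕ, ∀ hN : N ≤ m, Spt N 0 = Spt 0 0 := by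
    intro N hN
    rw [hSpt N hN 0, hSpt 0 h0m 0]
    have ex : xS N 0 = xS 0 0 := ιc.injective (by
      rw [hxS N hN 0, hxS 0 h0m 0]; simp only [Nat.cast_zero, zero_mul, zero_add])
    have ey : yS N 0 = yS 0 0 := ιc.injective (by
      rw [hyS N hN 0, hyS 0 h0m 0]; simp only [Nat.cast_zero, zero_mul, zero_add])
    have eX : XS N 0 = XS 0 0 := by
      apply (algebraMap M (AlgebraicClosure F)).injective
      change ((XS N 0 : M) : AlgebraicClosure F) = ((XS 0 0 : M) : AlgebraicClosure F)
      rw [hXS N hN 0, hXS 0 h0m 0, ex]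
    have eY : YS N 0 = YS 0 0 := by
      apply (algebraMap M (AlgebraicClosure F)).injective
      change ((YS N 0 : M) : AlgebraicClosure F) = ((YS 0 0 : M) : AlgebraicClosure F)
      rw [hYS N hN 0, hYS 0 h0m 0, ey]
    simp only [eX, eY]
  have hPid : ∀ N : ℕ, ∀ hN : N ≤ m, ∀ k : ℕ, Spt N k = k • Ypt N + Spt 0 0 := by
    intro N hN k
    rw [← hS0 N hN, hSpt N hN k, hSpt N hN 0, hYpt N hN]
    exact nsmul_some_add_some_eq_some_of_readings e M ιc ιv L h₂ h₃ (huN N) (hSN N) (hxY N hN) (hyY N hN) (hXY N hN) (hYY N hN)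
      (xS N) (yS N) (XS N) (YS N) (hxS N hN) (hyS N hN) (hXS N hN) (hYS N hN) (hnS N hN) k
  -- `R ∉ E₁`
  have hRk : Spt 0 0 ∉ kernel (NormedField.valuation (K := M)) (curveOver M (((⟨1, -1, 0, -2, -1⟩ : WeierstrassCurve ℤ).map (Int.castRingHom ℤ_[p])).map ((LTCoeff.of F).toRingHom.comp e.symm.toRingHom))) := by
    have hpU : p • Spt 0 0 = 0 := by subst hp2; exact hR2
    rw [hSpt 0 h0m 0] at hpU ⊢
    exact not_mem_kernel_some_of_readings_of_nsmul_eq_zero e hq hπ he hA hP _ hV hp hϖ M ιc ιv ψ j hψj L h₂ h₃ hT hs hQr hPr hT0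
      hTP hidX hΩL hαΩ (hSN 0 0) (hWN 0 0) (hZN 0 0) (hαSN 0 0) (hexclN 0 0) (hQ _ (hWN 0 0) (hZN 0 0)) hx₀ hy₀ hx₁
      (hxS 0 h0m 0) (hyS 0 h0m 0) (hxW 0 h0m 0) (hyW 0 h0m 0) (hxZ 0 h0m 0) (hyZ 0 h0m 0) (hXS 0 h0m 0) (hYS 0 h0m 0)
      (hXW 0 h0m 0) (hYW 0 h0m 0) (hXZ 0 h0m 0) (hYZ 0 h0m 0) (hnU' := hnS 0 h0m 0) hpU
  -- `Y 0 + R ∉ E₁`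
  have h₀ : Ypt 0 + Spt 0 0 ∉ kernel (NormedField.valuation (K := M)) (curveOver M (((⟨1, -1, 0, -2, -1⟩ : WeierstrassCurve ℤ).map (Int.castRingHom ℤ_[p])).map ((LTCoeff.of F).toRingHom.comp e.symm.toRingHom))) := by
    have e1 : Ypt 0 + Spt 0 0 = Spt 0 1 := by rw [hPid 0 h0m 1, one_smul]
    have h2U : 2 • Spt 0 1 = 0 := by
      rw [hPid 0 h0m 1, one_smul, smul_add, hR2, add_zero]
      have h1 := htor 0 h0m
      rwa [pow_one] at h1
    have hpU : p • Spt 0 1 = 0 := by subst hp2; exact h2U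
    rw [e1]
    rw [hSpt 0 h0m 1] at hpU ⊢
    exact not_mem_kernel_some_of_readings_of_nsmul_eq_zero e hq hπ he hA hP _ hV hp hϖ M ιc ιv ψ j hψj L h₂ h₃ hT hs hQr hPr hT0
      hTP hidX hΩL hαΩ (hSN 0 1) (hWN 0 1) (hZN 0 1) (hαSN 0 1) (hexclN 0 1) (hQ _ (hWN 0 1) (hZN 0 1)) hx₀ hy₀ hx₁
      (hxS 0 h0m 1) (hyS 0 h0m 1) (hxW 0 h0m 1) (hyW 0 h0m 1) (hxZ 0 h0m 1) (hyZ 0 h0m 1) (hXS 0 h0m 1) (hYS 0 h0m 1)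
      (hXW 0 h0m 1) (hYW 0 h0m 1) (hXZ 0 h0m 1) (hYZ 0 h0m 1) (hnU' := hnS 0 h0m 1) hpU
  -- the descent hypothesis
  have hdesc : ∀ n < m, ∀ k : ℕ, 0 < k → k < 2 ^ (n + 2) → k • Ypt (n + 1) + Spt 0 0 ∈ kernel (NormedField.valuation (K := M)) (curveOver M (((⟨1, -1, 0, -2, -1⟩ : WeierstrassCurve ℤ).map (Int.castRingHom ℤ_[p])).map ((LTCoeff.of F).toRingHom.comp e.symm.toRingHom))) → k • Ypt n + Spt 0 0 ∈ kernel (NormedField.valuation (K := M)) (curveOver M (((⟨1, -1, 0, -2, -1⟩ : WeierstrassCurve ℤ).map (Int.castRingHom ℤ_[p])).map ((LTCoeff.of F).toRingHom.comp e.symm.toRingHom))) := by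
    intro n hn k _ _ hmem
    have hn1 : n + 1 ≤ m := hn
    have hn0 : n ≤ m := Nat.le_of_lt hn
    rw [← hPid (n + 1) hn1 k, hSpt (n + 1) hn1 k] at hmem
    rw [← hPid n hn0 k, hSpt n hn0 k]
    -- the congruence `α(k·u_{n+2} + ub) ≡ k·u_{n+1} + ub (mod L)` moves the `Q`-readings
    have hcong := mul_nsmul_divisionPt_succ_add_sub_mem ι₀ hL htr hβ hp0.ne_zero hub1 n k
    have eq_u : ιc (j αR) * ((k : ℂ) * (ι₀ ((β ^ (n + 1 + 1) : 𝓞 K) : K) * Ω - Ω / ι₀ ((π₀ ^ (n + 1 + 1) : 𝓞 K) : K)) + ub) =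
        ((k : ℂ) * (ι₀ ((β ^ (n + 1) : 𝓞 K) : K) * Ω - Ω / ι₀ ((π₀ ^ (n + 1) : 𝓞 K) : K)) + ub) + ((⟨_, hcong⟩ : L.lattice) : ℂ) := by
      rw [hα]
      push_cast
      simp only [map_pow]
      ring
    have hxq : ιc (xS n k) = ℘[L] (ιc (j αR) * ((k : ℂ) * (ι₀ ((β ^ (n + 1 + 1) : 𝓞 K) : K) * Ω - Ω / ι₀ ((π₀ ^ (n + 1 + 1) : 𝓞 K) : K)) + ub)) - ((⟨1, -1, 0, -2, -1⟩ : WeierstrassCurve ℤ).baseChange ℂ).b₂ / 12 := by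
      rw [hxS n hn0 k, eq_u, L.weierstrassP_add_coe]
    have hyq : ιc (yS n k) = (℘'[L] (ιc (j αR) * ((k : ℂ) * (ι₀ ((β ^ (n + 1 + 1) : 𝓞 K) : K) * Ω - Ω / ι₀ ((π₀ ^ (n + 1 + 1) : 𝓞 K) : K)) + ub)) - ((⟨1, -1, 0, -2, -1⟩ : WeierstrassCurve ℤ).baseChange ℂ).a₁ * (℘[L] (ιc (j αR) * ((k : ℂ) * (ι₀ ((β ^ (n + 1 + 1) : 𝓞 K) : K) * Ω - Ω / ι₀ ((π₀ ^ (n + 1 + 1) : 𝓞 K) : K)) + ub)) - ((⟨1, -1, 0, -2, -1⟩ : WeierstrassCurve ℤ).baseChange ℂ).b₂ / 12) - ((⟨1, -1, 0, -2, -1⟩ : WeierstrassCurve ℤ).baseChange ℂ).a₃) / 2 := by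
      rw [hyS n hn0 k, eq_u, L.weierstrassP_add_coe, L.derivWeierstrassP_add_coe]
    have hfin : (.some (XS n k) (YS n k) (hnS n hn0 k) : (curveOver M (((⟨1, -1, 0, -2, -1⟩ : WeierstrassCurve ℤ).map (Int.castRingHom ℤ_[p])).map ((LTCoeff.of F).toRingHom.comp e.symm.toRingHom))).toAffine.Point) ∈
        kernel (NormedField.valuation (K := M)) (curveOver M (((⟨1, -1, 0, -2, -1⟩ : WeierstrassCurve ℤ).map (Int.castRingHom ℤ_[p])).map ((LTCoeff.of F).toRingHom.comp e.symm.toRingHom))) :=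
      some_mem_kernel_of_readings_of_mem_kernel e hq hπ he hP _ M ιc ιv ψ j hψj L h₂ h₃ hT hs hQr hPr hT0 hTP hidX hidY hΩL hαΩ
      (hSN (n + 1) k) (hWN (n + 1) k) (hZN (n + 1) k) (hαSN (n + 1) k) (hexclN (n + 1) k) (hQ _ (hWN (n + 1) k) (hZN (n + 1) k))
      hx₀ hy₀ hx₁ hy₁ (hxS (n + 1) hn1 k) (hyS (n + 1) hn1 k) (hxW (n + 1) hn1 k) (hyW (n + 1) hn1 k) (hxZ (n + 1) hn1 k)
      (hyZ (n + 1) hn1 k) hxq hyq (hXS (n + 1) hn1 k) (hYS (n + 1) hn1 k) (hXW (n + 1) hn1 k) (hYW (n + 1) hn1 k)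
      (hXZ (n + 1) hn1 k) (hYZ (n + 1) hn1 k) (hXS n hn0 k) (hYS n hn0 k) (hnU' := hnS (n + 1) hn1 k) (hnQ := hnS n hn0 k) hmem h20
    assumption
  -- assemble
  have key := @Cm7Kernel.forall_mem_kernel_of_cmDescent M _ (NormedField.valuation (K := M)) (curveOver M (((⟨1, -1, 0, -2, -1⟩ : WeierstrassCurve ℤ).map (Int.castRingHom ℤ_[p])).map ((LTCoeff.of F).toRingHom.comp e.symm.toRingHom))) _ _ (cm7_lane_a e M) hw2
    (Spt 0 0) hR0 hR2 hRk Ypt m htor h₀ hdesc m le_rfl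
  rw [hYpt m le_rfl] at key
  assumption


end Assembly

end Literature.NumberTheory.EllipticCurves

end
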